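import Summits.Ventures.HSemireg.WeilFrameRealCarrierAllDegrees
import Summits.Ventures.HSemireg.Mod4CarrierPureWeil

/-!
# Venture HSemireg — the PURE WEIL CLASSES in every degree: `dim S_k(c₊ + c₋) = 2C(2n,k)`, `dim S_k(c±) = C(2n,k)`
# (frame, Weil datum, and the real carrier `ΛH¹(A)`)

HONEST FRAMING. Part of the Lean index of the computation cell `pub-hsemireg` (seat w3-mod4-1 gen 9, W3 SPECIAL FIBRES,
MOD4-OFFSPLIT (E4) / row T1-9a / §13). Finite-dimensional exterior / linear algebra plus the tree's real carriers
(`complexBetti A.X 1`, `hodgeZeroOne`, the bridge's contraction spans `WedgeBridge.S`) and the Literature's Weil-type layer ONLY: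
no semiregularity map is constructed; nothing here says that HC / HC_CM / HC_AV holds; nothing here is a claim about any explicit
variety; no Literature fact is declared; NO definition is introduced. «`S_k` = the `HT^k`-contraction span» is the cell's dictionary
(STRUCTURE.md D9).

WHAT IS PROVED. THE PURE WEIL CLASSES IN EVERY DEGREE. Frame level (`n ≥ 1`, `a, b ≠ 0`): `finrank_S_pureWeil_nn_all`
(`dim S_k(a·w₊ + b·w₋) = 2C(2n,k)` for `1 ≤ k ≤ 2n-1` — gen 6's side/middle degrees + the palindromic upper degrees at `q = 0`),
`finrank_S_pureWeil_nn_zero'` / `_top'` (edges `= 1`), `finrank_S_pureWeilUp_nn_all` / `finrank_S_pureWeilLow_nn_all`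
(`dim S_k(a·w₊) = dim S_k(b·w₋) = C(2n,k)` for EVERY `0 ≤ k ≤ 2n`: one-sided lower/middle/upper/edges at `q = 0`, with
`M_f(0) = 0`, `middleM_zero_seq`). Weil-datum level (char `0`): `finrank_S_pureWeilDatum_all` / `_zero` / `_top`,
`finrank_S_pureWeilDatum_one_all`, `finrank_S_pureWeilDatum_low_all`. Real carriers (hypotheses as in gen 8's
`contractionRank_weilType_of_volume`): **`finrank_S_pureWeilType_all`** — `dim S_k(ĉ₊ + ĉ₋) = 2·C(2n,k)` for `1 ≤ k ≤ 2n-1`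
(TABLE R's pure-W row `(1, 12, 30, 40, 30, 12, 1)` at `n = 3`), **`finrank_S_pureWeilType_zero` / `_top`** (`= 1`),
**`finrank_S_pureWeilType_plus_all`** / **`finrank_S_pureWeilType_minus_all`** — `dim S_k(ĉ±) = C(2n,k)` for every `0 ≤ k ≤ 2n`.
Everything PROVED, 0 sorry.
References: [vanGeemen1994HodgeAV] 4.9, Lemma 5.2; [BuchweitzFlenner2008HH] Prop. 6.4.4; [BourbakiAlgebre1a3] Ch. III §11 no. 9.
-/

noncomputable section

open CliffordAlgebra (contractLeft)
open ExteriorAlgebra (ι)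
open Module CategoryTheory
open Literature.AlgebraicGeometry.Motives Literature.AlgebraicGeometry.HodgeTheory
open Literature.AlgebraicTopology.SingularHomology

namespace Summit.Ventures.HSemireg.WeilFrame

open Summit.Ventures.HSemireg.WedgeBridge Summit.Ventures.HSemireg.WeilCarrier Summit.Ventures.HSemireg.Mod4Carrier
open Summit.Ventures.HSemireg.Wedge.Hankel

/-! ### 1. The pure Weil classes in an adapted frame, in every degree -/

section Frame

variable {K : Type*} [Field K]

/-- `M_f` of the zero sequence vanishes (every entry carries a factor `q_j = 0`). -/
lemma middleM_zero_seq (n : ℕ) : Mod4.middleM n (fun _ => (0 : K)) = 0 := by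
  ext a b
  simp [Mod4.middleM]

variable {V : Type*} [AddCommGroup V] [Module K V] {n : ℕ} (bV : Basis (Fin ((n + n) + (n + n))) K V)

/-- **pure Weil class, both Weil vectors alive, EVERY interior degree** (`1 ≤ k ≤ 2n - 1`, `a, b ≠ 0`):
`dim S_k(a·w₊ + b·w₋) = 2·C(2n,k)` — gen 6's `finrank_S_pureWeil_nn_deg` / `_middle` for `k ≤ n` and the palindromic upper
degrees `finrank_S_weil_nn_deg_dual` at `q = 0`. [cite: BuchweitzFlenner2008HH, Prop. 6.4.4] [cite: BourbakiAlgebre1a3, Ch. III §11 no. 9] -/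
theorem finrank_S_pureWeil_nn_all {k : ℕ} (hk1 : 1 ≤ k) (hk : k + 1 ≤ n + n) {a b : K} (ha : a ≠ 0) (hb : b ≠ 0) :
    finrank K ↥(S K (Lsp bV) k (a • wUp bV n + b • wLow bV n)) = 2 * (n + n).choose k := by
  rcases Nat.lt_trichotomy k n with h | h | h
  · exact finrank_S_pureWeil_nn_deg bV hk1 (by omega) ha hb
  · subst h
    exact finrank_S_pureWeil_nn_middle bV (by omega) ha hb
  · have h' := finrank_S_weil_nn_deg_dual bV (k := k) (k' := n + n - k) (by omega) (by omega) (by omega)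
      (fun _ => (0 : K)) ha hb
    rw [Ecl_zero_seq, zero_add] at h'
    simp only [hankel1_zero_seq, Matrix.rank_zero, mul_zero, add_zero] at h'
    rw [← Nat.choose_symm_of_eq_add (show n + n = k + (n + n - k) by omega)] at h'
    omega

/-- pure Weil class, edge row `0`: `dim S_0(a·w₊ + b·w₋) = 1` (`n ≥ 1`, `a ≠ 0`). [cite: BuchweitzFlenner2008HH, Prop. 6.4.4] -/
theorem finrank_S_pureWeil_nn_zero' (hn : 1 ≤ n) {a : K} (b : K) (ha : a ≠ 0) :
    finrank K ↥(S K (Lsp bV) 0 (a • wUp bV n + b • wLow bV n)) = 1 := by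
  have h := finrank_S_weil_nn_zero bV hn (fun _ => (0 : K)) (b := b) (Or.inl ha)
  rw [Ecl_zero_seq, zero_add] at h
  exact h

/-- pure Weil class, edge row `2n`: `dim S_{2n}(a·w₊ + b·w₋) = 1` (`n ≥ 1`, `a ≠ 0`). [cite: BuchweitzFlenner2008HH, Prop. 6.4.4] -/
theorem finrank_S_pureWeil_nn_top' (hn : 1 ≤ n) {a : K} (b : K) (ha : a ≠ 0) :
    finrank K ↥(S K (Lsp bV) (n + n) (a • wUp bV n + b • wLow bV n)) = 1 := by
  have h := finrank_S_weil_nn_top bV hn (fun _ => (0 : K)) (b := b) (Or.inl ha)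
  rw [Ecl_zero_seq, zero_add] at h
  exact h

/-- **pure one-sided Weil class `a·w₊` in EVERY degree `0 ≤ k ≤ 2n`:** `dim S_k(a·w₊) = C(2n,k)` (`n ≥ 1`, `a ≠ 0`, char `0`) —
th-7's one-sided lower/middle/upper degrees and gen 7's one-sided edges at `q = 0` (`M_f(0) = 0`).
[cite: BuchweitzFlenner2008HH, Prop. 6.4.4] [cite: BourbakiAlgebre1a3, Ch. III §11 no. 9] -/
theorem finrank_S_pureWeilUp_nn_all [CharZero K] (hn : 1 ≤ n) {k : ℕ} (hk : k ≤ n + n) {a : K} (ha : a ≠ 0) :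
    finrank K ↥(S K (Lsp bV) k (a • wUp bV n)) = (n + n).choose k := by
  rcases Nat.eq_zero_or_pos k with h0 | hpos
  · subst h0
    have h := finrank_S_weil_nn_one_zero bV hn (fun _ => (0 : K)) ha
    rw [Ecl_zero_seq, zero_add] at h
    rw [h, Nat.choose_zero_right]
  rcases Nat.lt_trichotomy k n with h | h | h
  · have h' := finrank_S_weil_nn_one bV (m := k) (by omega) (fun _ => (0 : K)) ha
    rw [Ecl_zero_seq, zero_add] at h'
    simp only [hankel1_zero_seq, Matrix.rank_zero, mul_zero, add_zero] at h'
    exact h'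
  · subst h
    have h' := finrank_S_weil_nn_one_middle_Mf_charZero bV hn (fun _ => (0 : K)) ha
    rw [Ecl_zero_seq, zero_add] at h'
    simp only [hankel1_zero_seq, middleM_zero_seq, Matrix.rank_zero, mul_zero, add_zero, zero_add] at h'
    omega
  rcases Nat.lt_or_ge k (n + n) with hlt | hge
  · have h' := finrank_S_weil_nn_one_dual bV (m := k) (m' := n + n - k) (by omega) (by omega) (fun _ => (0 : K)) ha
    rw [Ecl_zero_seq, zero_add] at h'
    simp only [hankel1_zero_seq, Matrix.rank_zero, mul_zero, add_zero] at h'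
    rw [← Nat.choose_symm_of_eq_add (show n + n = k + (n + n - k) by omega)] at h'
    exact h'
  · have hk2 : k = n + n := le_antisymm hk hge
    subst hk2
    have h' := finrank_S_weil_nn_one_top bV hn (fun _ => (0 : K)) ha
    rw [Ecl_zero_seq, zero_add] at h'
    rw [h', Nat.choose_self]

/-- **pure one-sided Weil class `b·w₋` in EVERY degree `0 ≤ k ≤ 2n`:** `dim S_k(b·w₋) = C(2n,k)` (`n ≥ 1`, `b ≠ 0`, char `0`) —
gen 7's `b`-side column at `q = 0`. [cite: BuchweitzFlenner2008HH, Prop. 6.4.4] [cite: BourbakiAlgebre1a3, Ch. III §11 no. 9] -/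
theorem finrank_S_pureWeilLow_nn_all [CharZero K] (hn : 1 ≤ n) {k : ℕ} (hk : k ≤ n + n) {b : K} (hb : b ≠ 0) :
    finrank K ↥(S K (Lsp bV) k (b • wLow bV n)) = (n + n).choose k := by
  rcases Nat.eq_zero_or_pos k with h0 | hpos
  · subst h0
    have h := finrank_S_weil_nn_low_zero bV hn (fun _ => (0 : K)) hb
    rw [Ecl_zero_seq, zero_add] at h
    rw [h, Nat.choose_zero_right]
  rcases Nat.lt_trichotomy k n with h | h | h
  · have h' := finrank_S_weil_nn_low bV (m := k) (by omega) (fun _ => (0 : K)) hb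
    rw [Ecl_zero_seq, zero_add] at h'
    simp only [hankel1_zero_seq, Matrix.rank_zero, mul_zero, add_zero] at h'
    exact h'
  · subst h
    have h' := finrank_S_weil_nn_low_middle_Mf_charZero bV hn (fun _ => (0 : K)) hb
    rw [Ecl_zero_seq, zero_add] at h'
    simp only [hankel1_zero_seq, middleM_zero_seq, Matrix.rank_zero, mul_zero, add_zero, zero_add] at h'
    omega
  rcases Nat.lt_or_ge k (n + n) with hlt | hge
  · have h' := finrank_S_weil_nn_low_dual bV (m := k) (m' := n + n - k) (by omega) (by omega) (fun _ => (0 : K)) hb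
    rw [Ecl_zero_seq, zero_add] at h'
    simp only [hankel1_zero_seq, Matrix.rank_zero, mul_zero, add_zero] at h'
    rw [← Nat.choose_symm_of_eq_add (show n + n = k + (n + n - k) by omega)] at h'
    exact h'
  · have hk2 : k = n + n := le_antisymm hk hge
    subst hk2
    have h' := finrank_S_weil_nn_low_top bV hn (fun _ => (0 : K)) hb
    rw [Ecl_zero_seq, zero_add] at h'
    rw [h', Nat.choose_self]

end Frame

/-! ### 2. The pure Weil classes of a Weil datum (no frame in the statement) -/

section Datum

variable {K : Type*} [Field K] {V : Type*} [AddCommGroup V] [Module K V]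

/-- **pure Weil class of a Weil datum, every interior degree** (`1 ≤ k ≤ 2n - 1`): `dim S_k(w₊ + w₋) = 2·C(2n,k)`.
[cite: BuchweitzFlenner2008HH, Prop. 6.4.4] [cite: BourbakiAlgebre1a3, Ch. III §11 no. 9] -/
theorem finrank_S_pureWeilDatum_all [FiniteDimensional K V] [CharZero K] {n : ℕ} {L P Q : Submodule K V}
    {Θ wP wQ : ExteriorAlgebra K V} (hV : finrank K V = (n + n) + (n + n)) (hPQ : Disjoint P Q)
    (hL : finrank K L = n + n) (hLQ : finrank K ↥(L ⊓ Q) = n) (hLP : finrank K ↥(L ⊓ P) = n)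
    (hP : finrank K ↥P = n + n) (hQ : finrank K ↥Q = n + n) (hΘ : Θ ∈ Submodule.span K
      {z : ExteriorAlgebra K V | ∃ x l : V, ((x ∈ P ∧ l ∈ L ⊓ Q) ∨ (x ∈ Q ∧ l ∈ L ⊓ P)) ∧ z = ι K x * ι K l})
    (hnd : ∀ l ∈ (L : Set V), ι K l ∈ Submodule.span K {y : ExteriorAlgebra K V |
      ∃ φ ∈ {θ : Module.Dual K V | ∀ q ∈ L, θ q = 0}, y = contractLeft φ Θ})
    (hwP : wP ∈ ((⋀[K]^(finrank K ↥P) ↥P).map (ExteriorAlgebra.map P.subtype).toLinearMap)) (hwP0 : wP ≠ 0)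
    (hwQ : wQ ∈ ((⋀[K]^(finrank K ↥Q) ↥Q).map (ExteriorAlgebra.map Q.subtype).toLinearMap)) (hwQ0 : wQ ≠ 0)
    {k : ℕ} (hk1 : 1 ≤ k) (hk : k + 1 ≤ n + n) :
    finrank K ↥(S K L k (wP + wQ)) = 2 * (n + n).choose k := by
  obtain ⟨bV, a, b, ha, hb, hLsp, -, rfl, rfl, -⟩ :=
    exists_frame_of_weilDatum hV hPQ hL hLQ hLP hP hQ hΘ hnd hwP hwP0 hwQ hwQ0
  rw [← hLsp]
  exact finrank_S_pureWeil_nn_all bV hk1 hk ha hb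

/-- pure Weil class of a Weil datum, edge row `0`: `dim S_0(w₊ + w₋) = 1` (`n ≥ 1`). [cite: BuchweitzFlenner2008HH, Prop. 6.4.4] -/
theorem finrank_S_pureWeilDatum_zero [FiniteDimensional K V] [CharZero K] {n : ℕ} {L P Q : Submodule K V}
    {Θ wP wQ : ExteriorAlgebra K V} (hV : finrank K V = (n + n) + (n + n)) (hPQ : Disjoint P Q)
    (hL : finrank K L = n + n) (hLQ : finrank K ↥(L ⊓ Q) = n) (hLP : finrank K ↥(L ⊓ P) = n)
    (hP : finrank K ↥P = n + n) (hQ : finrank K ↥Q = n + n) (hΘ : Θ ∈ Submodule.span K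
      {z : ExteriorAlgebra K V | ∃ x l : V, ((x ∈ P ∧ l ∈ L ⊓ Q) ∨ (x ∈ Q ∧ l ∈ L ⊓ P)) ∧ z = ι K x * ι K l})
    (hnd : ∀ l ∈ (L : Set V), ι K l ∈ Submodule.span K {y : ExteriorAlgebra K V |
      ∃ φ ∈ {θ : Module.Dual K V | ∀ q ∈ L, θ q = 0}, y = contractLeft φ Θ})
    (hwP : wP ∈ ((⋀[K]^(finrank K ↥P) ↥P).map (ExteriorAlgebra.map P.subtype).toLinearMap)) (hwP0 : wP ≠ 0)
    (hwQ : wQ ∈ ((⋀[K]^(finrank K ↥Q) ↥Q).map (ExteriorAlgebra.map Q.subtype).toLinearMap)) (hwQ0 : wQ ≠ 0)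
    (hn : 1 ≤ n) :
    finrank K ↥(S K L 0 (wP + wQ)) = 1 := by
  obtain ⟨bV, a, b, ha, -, hLsp, -, rfl, rfl, -⟩ :=
    exists_frame_of_weilDatum hV hPQ hL hLQ hLP hP hQ hΘ hnd hwP hwP0 hwQ hwQ0
  rw [← hLsp]
  exact finrank_S_pureWeil_nn_zero' bV hn b ha

/-- pure Weil class of a Weil datum, edge row `2n`: `dim S_{2n}(w₊ + w₋) = 1` (`n ≥ 1`). [cite: BuchweitzFlenner2008HH, Prop. 6.4.4] -/
theorem finrank_S_pureWeilDatum_top [FiniteDimensional K V] [CharZero K] {n : ℕ} {L P Q : Submodule K V}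
    {Θ wP wQ : ExteriorAlgebra K V} (hV : finrank K V = (n + n) + (n + n)) (hPQ : Disjoint P Q)
    (hL : finrank K L = n + n) (hLQ : finrank K ↥(L ⊓ Q) = n) (hLP : finrank K ↥(L ⊓ P) = n)
    (hP : finrank K ↥P = n + n) (hQ : finrank K ↥Q = n + n) (hΘ : Θ ∈ Submodule.span K
      {z : ExteriorAlgebra K V | ∃ x l : V, ((x ∈ P ∧ l ∈ L ⊓ Q) ∨ (x ∈ Q ∧ l ∈ L ⊓ P)) ∧ z = ι K x * ι K l})
    (hnd : ∀ l ∈ (L : Set V), ι K l ∈ Submodule.span K {y : ExteriorAlgebra K V |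
      ∃ φ ∈ {θ : Module.Dual K V | ∀ q ∈ L, θ q = 0}, y = contractLeft φ Θ})
    (hwP : wP ∈ ((⋀[K]^(finrank K ↥P) ↥P).map (ExteriorAlgebra.map P.subtype).toLinearMap)) (hwP0 : wP ≠ 0)
    (hwQ : wQ ∈ ((⋀[K]^(finrank K ↥Q) ↥Q).map (ExteriorAlgebra.map Q.subtype).toLinearMap)) (hwQ0 : wQ ≠ 0)
    (hn : 1 ≤ n) :
    finrank K ↥(S K L (n + n) (wP + wQ)) = 1 := by
  obtain ⟨bV, a, b, ha, -, hLsp, -, rfl, rfl, -⟩ :=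
    exists_frame_of_weilDatum hV hPQ hL hLQ hLP hP hQ hΘ hnd hwP hwP0 hwQ hwQ0
  rw [← hLsp]
  exact finrank_S_pureWeil_nn_top' bV hn b ha

/-- **pure one-sided Weil class `w₊` of a Weil datum in EVERY degree `0 ≤ k ≤ 2n`:** `dim S_k(w₊) = C(2n,k)` (`n ≥ 1`).
[cite: BuchweitzFlenner2008HH, Prop. 6.4.4] [cite: BourbakiAlgebre1a3, Ch. III §11 no. 9] -/
theorem finrank_S_pureWeilDatum_one_all [FiniteDimensional K V] [CharZero K] {n : ℕ} {L P Q : Submodule K V}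
    {Θ wP : ExteriorAlgebra K V} (hV : finrank K V = (n + n) + (n + n)) (hPQ : Disjoint P Q)
    (hL : finrank K L = n + n) (hLQ : finrank K ↥(L ⊓ Q) = n) (hLP : finrank K ↥(L ⊓ P) = n)
    (hP : finrank K ↥P = n + n) (hQ : finrank K ↥Q = n + n) (hΘ : Θ ∈ Submodule.span K
      {z : ExteriorAlgebra K V | ∃ x l : V, ((x ∈ P ∧ l ∈ L ⊓ Q) ∨ (x ∈ Q ∧ l ∈ L ⊓ P)) ∧ z = ι K x * ι K l})
    (hnd : ∀ l ∈ (L : Set V), ι K l ∈ Submodule.span K {y : ExteriorAlgebra K V |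
      ∃ φ ∈ {θ : Module.Dual K V | ∀ q ∈ L, θ q = 0}, y = contractLeft φ Θ})
    (hwP : wP ∈ ((⋀[K]^(finrank K ↥P) ↥P).map (ExteriorAlgebra.map P.subtype).toLinearMap)) (hwP0 : wP ≠ 0)
    (hn : 1 ≤ n) {k : ℕ} (hk : k ≤ n + n) :
    finrank K ↥(S K L k wP) = (n + n).choose k := by
  obtain ⟨-, wQ, hwQ, hwQ0⟩ := exists_mem_topLine_ne_zero hV hPQ hL hLQ hLP hP hQ hΘ hnd
  obtain ⟨bV, a, b, ha, -, hLsp, -, rfl, rfl, -⟩ :=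
    exists_frame_of_weilDatum hV hPQ hL hLQ hLP hP hQ hΘ hnd hwP hwP0 hwQ hwQ0
  rw [← hLsp]
  exact finrank_S_pureWeilUp_nn_all bV hn hk ha

/-- **pure one-sided Weil class `w₋` of a Weil datum in EVERY degree `0 ≤ k ≤ 2n`:** `dim S_k(w₋) = C(2n,k)` (`n ≥ 1`).
[cite: BuchweitzFlenner2008HH, Prop. 6.4.4] [cite: BourbakiAlgebre1a3, Ch. III §11 no. 9] -/
theorem finrank_S_pureWeilDatum_low_all [FiniteDimensional K V] [CharZero K] {n : ℕ} {L P Q : Submodule K V}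
    {Θ wQ : ExteriorAlgebra K V} (hV : finrank K V = (n + n) + (n + n)) (hPQ : Disjoint P Q)
    (hL : finrank K L = n + n) (hLQ : finrank K ↥(L ⊓ Q) = n) (hLP : finrank K ↥(L ⊓ P) = n)
    (hP : finrank K ↥P = n + n) (hQ : finrank K ↥Q = n + n) (hΘ : Θ ∈ Submodule.span K
      {z : ExteriorAlgebra K V | ∃ x l : V, ((x ∈ P ∧ l ∈ L ⊓ Q) ∨ (x ∈ Q ∧ l ∈ L ⊓ P)) ∧ z = ι K x * ι K l})
    (hnd : ∀ l ∈ (L : Set V), ι K l ∈ Submodule.span K {y : ExteriorAlgebra K V |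
      ∃ φ ∈ {θ : Module.Dual K V | ∀ q ∈ L, θ q = 0}, y = contractLeft φ Θ})
    (hwQ : wQ ∈ ((⋀[K]^(finrank K ↥Q) ↥Q).map (ExteriorAlgebra.map Q.subtype).toLinearMap)) (hwQ0 : wQ ≠ 0)
    (hn : 1 ≤ n) {k : ℕ} (hk : k ≤ n + n) :
    finrank K ↥(S K L k wQ) = (n + n).choose k := by
  obtain ⟨⟨wP, hwP, hwP0⟩, -⟩ := exists_mem_topLine_ne_zero hV hPQ hL hLQ hLP hP hQ hΘ hnd
  obtain ⟨bV, a, b, -, hb, hLsp, -, rfl, rfl, -⟩ :=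
    exists_frame_of_weilDatum hV hPQ hL hLQ hLP hP hQ hΘ hnd hwP hwP0 hwQ hwQ0
  rw [← hLsp]
  exact finrank_S_pureWeilLow_nn_all bV hn hk hb

end Datum

/-! ### 3. The pure Weil classes on the real carrier `ΛH¹(A)` -/

section RealCarrier

variable {A : AbelianVariety ℂ}

/-- **THE PURE WEIL CLASS `c₊ + c₋` ON THE REAL CARRIER, EVERY INTERIOR DEGREE** (`1 ≤ k ≤ 2n - 1`): for `A` of dimension `2n`,
`φ ≫ φ = -(d • 𝟙 A)`, `d ≥ 1`, `P, Q` the `±i√d`-eigenspaces, `dim (P ⊓ H^{1,0}) = n`, a `K`-symmetric `(1,1)`-class `h` with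
`ĥ^{2n} ≠ 0`, and NON-ZERO Weil classes `c₊ ∈ E₊`, `c₋ ∈ E₋`: `dim S_k(ĉ₊ + ĉ₋) = 2·C(2n,k)` — TABLE R's pure-W row
(`(1, 12, 30, 40, 30, 12, 1)` for sixfolds). [cite: BuchweitzFlenner2008HH, Prop. 6.4.4] [cite: vanGeemen1994HodgeAV, 4.9 and Lemma 5.2] -/
theorem finrank_S_pureWeilType_all (hA : IsSmoothProjective A.dim A.X) {n d : ℕ} (hdim : A.dim = n + n) (hd : 0 < d)
    {φ : A ⟶ A} (hφ : φ ≫ φ = -(d • 𝟙 A)) {P Q : Submodule ℂ (complexBetti A.X 1)}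
    (hP : P = Module.End.eigenspace (complexBetti.map φ.hom.hom.hom 1).hom (Complex.I * (Real.sqrt d : ℂ)))
    (hQ : Q = Module.End.eigenspace (complexBetti.map φ.hom.hom.hom 1).hom (-(Complex.I * (Real.sqrt d : ℂ))))
    (hp : finrank ℂ ↥(P ⊓ hodgeOneZero hA) = n) {h : complexBetti A.X 2}
    (hh : complexBetti.map φ.hom.hom.hom 2 h = (d : ℂ) • h) (h11 : IsOfHodgeType A.dim A.X 2 1 1 h)
    (hvol : ((⋀[ℂ]^2 (complexBetti A.X 1)).subtype ((abelianVarietyCohomologyExteriorH1_holds.equiv A 2).symm h)) ^ (n + n) ≠ 0)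
    {cP : complexBetti A.X (2 * n)} (hcP : cP ∈ weilClassesPlus A φ n d) (hcP0 : cP ≠ 0)
    {cQ : complexBetti A.X (2 * n)} (hcQ : cQ ∈ weilClassesMinus A φ n d) (hcQ0 : cQ ≠ 0)
    {k : ℕ} (hk1 : 1 ≤ k) (hk : k + 1 ≤ n + n) :
    finrank ℂ ↥(S ℂ (hodgeZeroOne hA) k
        ((⋀[ℂ]^(2 * n) (complexBetti A.X 1)).subtype ((abelianVarietyCohomologyExteriorH1_holds.equiv A (2 * n)).symm cP) +
          (⋀[ℂ]^(2 * n) (complexBetti A.X 1)).subtype ((abelianVarietyCohomologyExteriorH1_holds.equiv A (2 * n)).symm cQ))) =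
      2 * (n + n).choose k := by
  haveI : Module.Finite ℂ (complexBetti A.X 1) := abelianVarietyCohomologyExteriorH1_holds.finite_one A
  obtain ⟨hV, hPQ, hL, hLQ, hLP, hP2, hQ2⟩ := weilBlocks_of_sq_eq_neg hA hdim hd hφ hP hQ hp
  exact finrank_S_pureWeilDatum_all hV hPQ hL hLQ hLP hP2 hQ2 (exteriorOf_mem_span_weilGen hA hd hφ hP hQ hh h11)
    (hnd_of_polarisation_pow_ne_zero hA hdim hd hφ hP hQ hh h11 hvol)
    (exteriorOf_mem_topLine_of_mem_weilClassesPlus hdim hd hφ hP hcP) (exteriorOf_ne_zero hcP0)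
    (exteriorOf_mem_topLine_of_mem_weilClassesMinus hdim hd hφ hQ hcQ) (exteriorOf_ne_zero hcQ0) hk1 hk

/-- pure Weil class on the real carrier, edge row `0`: `dim S_0(ĉ₊ + ĉ₋) = 1` (`n ≥ 1`). [cite: BuchweitzFlenner2008HH, Prop. 6.4.4] -/
theorem finrank_S_pureWeilType_zero (hA : IsSmoothProjective A.dim A.X) {n d : ℕ} (hdim : A.dim = n + n) (hd : 0 < d)
    {φ : A ⟶ A} (hφ : φ ≫ φ = -(d • 𝟙 A)) {P Q : Submodule ℂ (complexBetti A.X 1)}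
    (hP : P = Module.End.eigenspace (complexBetti.map φ.hom.hom.hom 1).hom (Complex.I * (Real.sqrt d : ℂ)))
    (hQ : Q = Module.End.eigenspace (complexBetti.map φ.hom.hom.hom 1).hom (-(Complex.I * (Real.sqrt d : ℂ))))
    (hp : finrank ℂ ↥(P ⊓ hodgeOneZero hA) = n) {h : complexBetti A.X 2}
    (hh : complexBetti.map φ.hom.hom.hom 2 h = (d : ℂ) • h) (h11 : IsOfHodgeType A.dim A.X 2 1 1 h)
    (hvol : ((⋀[ℂ]^2 (complexBetti A.X 1)).subtype ((abelianVarietyCohomologyExteriorH1_holds.equiv A 2).symm h)) ^ (n + n) ≠ 0)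
    {cP : complexBetti A.X (2 * n)} (hcP : cP ∈ weilClassesPlus A φ n d) (hcP0 : cP ≠ 0)
    {cQ : complexBetti A.X (2 * n)} (hcQ : cQ ∈ weilClassesMinus A φ n d) (hcQ0 : cQ ≠ 0) (hn : 1 ≤ n) :
    finrank ℂ ↥(S ℂ (hodgeZeroOne hA) 0
        ((⋀[ℂ]^(2 * n) (complexBetti A.X 1)).subtype ((abelianVarietyCohomologyExteriorH1_holds.equiv A (2 * n)).symm cP) +
          (⋀[ℂ]^(2 * n) (complexBetti A.X 1)).subtype ((abelianVarietyCohomologyExteriorH1_holds.equiv A (2 * n)).symm cQ))) = 1 := by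
  haveI : Module.Finite ℂ (complexBetti A.X 1) := abelianVarietyCohomologyExteriorH1_holds.finite_one A
  obtain ⟨hV, hPQ, hL, hLQ, hLP, hP2, hQ2⟩ := weilBlocks_of_sq_eq_neg hA hdim hd hφ hP hQ hp
  exact finrank_S_pureWeilDatum_zero hV hPQ hL hLQ hLP hP2 hQ2 (exteriorOf_mem_span_weilGen hA hd hφ hP hQ hh h11)
    (hnd_of_polarisation_pow_ne_zero hA hdim hd hφ hP hQ hh h11 hvol)
    (exteriorOf_mem_topLine_of_mem_weilClassesPlus hdim hd hφ hP hcP) (exteriorOf_ne_zero hcP0)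
    (exteriorOf_mem_topLine_of_mem_weilClassesMinus hdim hd hφ hQ hcQ) (exteriorOf_ne_zero hcQ0) hn

/-- pure Weil class on the real carrier, edge row `2n`: `dim S_{2n}(ĉ₊ + ĉ₋) = 1` (`n ≥ 1`). [cite: BuchweitzFlenner2008HH, Prop. 6.4.4] -/
theorem finrank_S_pureWeilType_top (hA : IsSmoothProjective A.dim A.X) {n d : ℕ} (hdim : A.dim = n + n) (hd : 0 < d)
    {φ : A ⟶ A} (hφ : φ ≫ φ = -(d • 𝟙 A)) {P Q : Submodule ℂ (complexBetti A.X 1)}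
    (hP : P = Module.End.eigenspace (complexBetti.map φ.hom.hom.hom 1).hom (Complex.I * (Real.sqrt d : ℂ)))
    (hQ : Q = Module.End.eigenspace (complexBetti.map φ.hom.hom.hom 1).hom (-(Complex.I * (Real.sqrt d : ℂ))))
    (hp : finrank ℂ ↥(P ⊓ hodgeOneZero hA) = n) {h : complexBetti A.X 2}
    (hh : complexBetti.map φ.hom.hom.hom 2 h = (d : ℂ) • h) (h11 : IsOfHodgeType A.dim A.X 2 1 1 h)
    (hvol : ((⋀[ℂ]^2 (complexBetti A.X 1)).subtype ((abelianVarietyCohomologyExteriorH1_holds.equiv A 2).symm h)) ^ (n + n) ≠ 0)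
    {cP : complexBetti A.X (2 * n)} (hcP : cP ∈ weilClassesPlus A φ n d) (hcP0 : cP ≠ 0)
    {cQ : complexBetti A.X (2 * n)} (hcQ : cQ ∈ weilClassesMinus A φ n d) (hcQ0 : cQ ≠ 0) (hn : 1 ≤ n) :
    finrank ℂ ↥(S ℂ (hodgeZeroOne hA) (n + n)
        ((⋀[ℂ]^(2 * n) (complexBetti A.X 1)).subtype ((abelianVarietyCohomologyExteriorH1_holds.equiv A (2 * n)).symm cP) +
          (⋀[ℂ]^(2 * n) (complexBetti A.X 1)).subtype ((abelianVarietyCohomologyExteriorH1_holds.equiv A (2 * n)).symm cQ))) = 1 := by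
  haveI : Module.Finite ℂ (complexBetti A.X 1) := abelianVarietyCohomologyExteriorH1_holds.finite_one A
  obtain ⟨hV, hPQ, hL, hLQ, hLP, hP2, hQ2⟩ := weilBlocks_of_sq_eq_neg hA hdim hd hφ hP hQ hp
  exact finrank_S_pureWeilDatum_top hV hPQ hL hLQ hLP hP2 hQ2 (exteriorOf_mem_span_weilGen hA hd hφ hP hQ hh h11)
    (hnd_of_polarisation_pow_ne_zero hA hdim hd hφ hP hQ hh h11 hvol)
    (exteriorOf_mem_topLine_of_mem_weilClassesPlus hdim hd hφ hP hcP) (exteriorOf_ne_zero hcP0)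
    (exteriorOf_mem_topLine_of_mem_weilClassesMinus hdim hd hφ hQ hcQ) (exteriorOf_ne_zero hcQ0) hn

/-- **A SINGLE WEIL LINE CLASS `c₊ ∈ E₊` ON THE REAL CARRIER, EVERY DEGREE `0 ≤ k ≤ 2n`:** `dim S_k(ĉ₊) = C(2n,k)` (`n ≥ 1`).
[cite: BuchweitzFlenner2008HH, Prop. 6.4.4] [cite: vanGeemen1994HodgeAV, 4.9] -/
theorem finrank_S_pureWeilType_plus_all (hA : IsSmoothProjective A.dim A.X) {n d : ℕ} (hdim : A.dim = n + n) (hd : 0 < d)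
    {φ : A ⟶ A} (hφ : φ ≫ φ = -(d • 𝟙 A)) {P Q : Submodule ℂ (complexBetti A.X 1)}
    (hP : P = Module.End.eigenspace (complexBetti.map φ.hom.hom.hom 1).hom (Complex.I * (Real.sqrt d : ℂ)))
    (hQ : Q = Module.End.eigenspace (complexBetti.map φ.hom.hom.hom 1).hom (-(Complex.I * (Real.sqrt d : ℂ))))
    (hp : finrank ℂ ↥(P ⊓ hodgeOneZero hA) = n) {h : complexBetti A.X 2}
    (hh : complexBetti.map φ.hom.hom.hom 2 h = (d : ℂ) • h) (h11 : IsOfHodgeType A.dim A.X 2 1 1 h)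
    (hvol : ((⋀[ℂ]^2 (complexBetti A.X 1)).subtype ((abelianVarietyCohomologyExteriorH1_holds.equiv A 2).symm h)) ^ (n + n) ≠ 0)
    {cP : complexBetti A.X (2 * n)} (hcP : cP ∈ weilClassesPlus A φ n d) (hcP0 : cP ≠ 0) (hn : 1 ≤ n) {k : ℕ}
    (hk : k ≤ n + n) :
    finrank ℂ ↥(S ℂ (hodgeZeroOne hA) k
        ((⋀[ℂ]^(2 * n) (complexBetti A.X 1)).subtype ((abelianVarietyCohomologyExteriorH1_holds.equiv A (2 * n)).symm cP))) =
      (n + n).choose k := by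
  haveI : Module.Finite ℂ (complexBetti A.X 1) := abelianVarietyCohomologyExteriorH1_holds.finite_one A
  obtain ⟨hV, hPQ, hL, hLQ, hLP, hP2, hQ2⟩ := weilBlocks_of_sq_eq_neg hA hdim hd hφ hP hQ hp
  exact finrank_S_pureWeilDatum_one_all hV hPQ hL hLQ hLP hP2 hQ2 (exteriorOf_mem_span_weilGen hA hd hφ hP hQ hh h11)
    (hnd_of_polarisation_pow_ne_zero hA hdim hd hφ hP hQ hh h11 hvol)
    (exteriorOf_mem_topLine_of_mem_weilClassesPlus hdim hd hφ hP hcP) (exteriorOf_ne_zero hcP0) hn hk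

/-- **A SINGLE WEIL LINE CLASS `c₋ ∈ E₋` ON THE REAL CARRIER, EVERY DEGREE `0 ≤ k ≤ 2n`:** `dim S_k(ĉ₋) = C(2n,k)` (`n ≥ 1`).
[cite: BuchweitzFlenner2008HH, Prop. 6.4.4] [cite: vanGeemen1994HodgeAV, 4.9] -/
theorem finrank_S_pureWeilType_minus_all (hA : IsSmoothProjective A.dim A.X) {n d : ℕ} (hdim : A.dim = n + n) (hd : 0 < d)
    {φ : A ⟶ A} (hφ : φ ≫ φ = -(d • 𝟙 A)) {P Q : Submodule ℂ (complexBetti A.X 1)}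
    (hP : P = Module.End.eigenspace (complexBetti.map φ.hom.hom.hom 1).hom (Complex.I * (Real.sqrt d : ℂ)))
    (hQ : Q = Module.End.eigenspace (complexBetti.map φ.hom.hom.hom 1).hom (-(Complex.I * (Real.sqrt d : ℂ))))
    (hp : finrank ℂ ↥(P ⊓ hodgeOneZero hA) = n) {h : complexBetti A.X 2}
    (hh : complexBetti.map φ.hom.hom.hom 2 h = (d : ℂ) • h) (h11 : IsOfHodgeType A.dim A.X 2 1 1 h)
    (hvol : ((⋀[ℂ]^2 (complexBetti A.X 1)).subtype ((abelianVarietyCohomologyExteriorH1_holds.equiv A 2).symm h)) ^ (n + n) ≠ 0)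
    {cQ : complexBetti A.X (2 * n)} (hcQ : cQ ∈ weilClassesMinus A φ n d) (hcQ0 : cQ ≠ 0) (hn : 1 ≤ n) {k : ℕ}
    (hk : k ≤ n + n) :
    finrank ℂ ↥(S ℂ (hodgeZeroOne hA) k
        ((⋀[ℂ]^(2 * n) (complexBetti A.X 1)).subtype ((abelianVarietyCohomologyExteriorH1_holds.equiv A (2 * n)).symm cQ))) =
      (n + n).choose k := by
  haveI : Module.Finite ℂ (complexBetti A.X 1) := abelianVarietyCohomologyExteriorH1_holds.finite_one A
  obtain ⟨hV, hPQ, hL, hLQ, hLP, hP2, hQ2⟩ := weilBlocks_of_sq_eq_neg hA hdim hd hφ hP hQ hp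
  exact finrank_S_pureWeilDatum_low_all hV hPQ hL hLQ hLP hP2 hQ2 (exteriorOf_mem_span_weilGen hA hd hφ hP hQ hh h11)
    (hnd_of_polarisation_pow_ne_zero hA hdim hd hφ hP hQ hh h11 hvol)
    (exteriorOf_mem_topLine_of_mem_weilClassesMinus hdim hd hφ hQ hcQ) (exteriorOf_ne_zero hcQ0) hn hk

end RealCarrier

end Summit.Ventures.HSemireg.WeilFrame

end
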